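import Summits.QuantumFields.BalabanUV.Beta.WardLocusQuarticTable
import Summits.QuantumFields.BalabanUV.Beta.RecursiveWSlot
import Summits.QuantumFields.BalabanUV.Beta.RecursiveStencilSlot

/-!
# `BalabanUV.Beta.WardLocusQuarticTableSlot` — binder row D1, SECOND-ORDER hW (W-side), SLOT-GENERIC part A: THE TABLE LAWS OF THE NEXT LEVEL's
# SECOND-ORDER FIELD TABLE `T2RecOf G (SpureRecOf V H G) M … (j+1)` (both slots) and of the level-`0` table, IN THE `hS₂` ∕ `hS₂''` SHAPE OF
# `KernelWardSymAssembly.divW_W2SymOfK_eq_conjV_add_residuals`, FROM the level-`j` KERNEL law of the slotted carrier `WrecOf … j`, the BORDER letter of the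
# `vh₂S` sector, the WILSON letter at level `0`, ONE units lock per level, and the order-one consistency (c1) at level `j` — the twin of
# `WardLocusQuarticTable` §3–§4 with `(coDressKBmAt ρ Lc (KInvStep Lc j), bhKStepAt j, axEc ρ, SpureRecAt, SrecAt, M1At, vhSAt ρ)` replaced by SLOTS
# `(G j, 𝕄, E, SpureRecOf V H G, SrecOf V H G, M, V)` (β sub-cell, BINDER-OWNERS row D1 OWNER `b2b-balaban-beta-an2`, gen 29; INTENT «SYM-hW-SECOND-ORDER»)

HONEST FRAMING (cell charter, verbatim): «discharging BetaPertH makes Bałaban's UV stability UNCONDITIONAL — a real constructive-QFT result; it is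
NOT the continuum limit and NOT the Clay problem.»  HONEST DEPENDENCY: continuum YM on T⁴ ⇐ BetaPertH ∧ nine spine estimates (0/9 proved);
BetaPertH ⇐ (D1) ∧ (D4) ∧ CAP+tail; G-an2-4 gates asym, D1 and NE2/3/4.
NOT IN PRINT; OUR BOOKKEEPING.  [folklore] kernel algebra over tree objects BY NAME (leaf-10's generic `WardLocusQuartic.tableLaw_e4OfKW_sector`, leaf-06's
generic `WardLocusQuarticTable.sectorLaw_add`∕`sectorLaw_add''`∕`tableLaw_e4OfKW_sector''`, an2-g18's `SecondOrderContactMmRead.mmRead_K2OfK_eq_e3OfK`,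
leaf-05's `RecursiveStencilSlot`∕`RecursiveWSlot`); the level-`j` kernel law, the sockets `Spr 𝕄`∕`Spr E`∕`RelInv (G j) 𝕄 E`∕`[E, X y] = 0`∕`hD`, the
ORDER-ONE CONSISTENCY (c1) `dM (G j) Lc (SpureRecOf … j) (M j) κ u = vertexOfK (G j) Lc (SrecOf … j) κ u` (for the comb a THEOREM —
`WardLocusQuarticWall.dM_SpureRecAt_M1At`; for a free multiplier slot `M` a LETTER tying `M` to the Λ-sector of `SrecOf`), the border letter, the
level-`0` Wilson letter and the units lock are DISPLAYED HYPOTHESES; no statement of Bałaban's papers, no `[cite:]`, no `def`, no `def … : Prop`;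
instantiates NO binder of the β-function wall.  NOT hW, NOT D1, NOT `BetaPertH`, NOT continuum, NOT Clay.

* §1 **`tableLaw_T2RecOf_succ` ∕ `tableLaw_T2RecOf_succ''`** — level `j+1`, both slots: the `e4OfKW` sector by `tableLaw_e4OfKW_sector`(″) with the
  `mm`-read identified with the cubic sector of `SpureRecOf … (j+1)` through (c1) (`mmRead_K2OfK_eq_e3OfK`), plus the border sector's letter (`sectorLaw_add`(″)).
  Generic constants `cE cVH cΛ cE₂ cB`, generic generator scale `ξ`, lock `cH′·(cE₂·wV4 (j+1))·ξ = (cE·wE (j+1))·ξ`.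
* §2 **`tableLaw_T2RecOf_zero` ∕ `tableLaw_T2RecOf_zero''`** — level `0`: Wilson letter (sector `cE₂ • wilsonW₂ d T` against `cE • wilsonA d`) + border
  letter (sector `cB • vh₂S` against `cVH • V`) ⇒ the laws of `T2RecOf … 0` against `SpureRecOf … 0` (pure `sectorLaw_add`(″) bookkeeping).
Provenance: β sub-cell, unit beta-an2 gen 29, 2026-08-21 (v1); over the files named above BY NAME; no existing file touched.
-/

noncomputable section

open Finset
open scoped BigOperators
open Literature.MathematicalPhysics.QuantumFieldTheory
open Literature.MathematicalPhysics.QuantumFieldTheory.Balaban1983to89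
open Literature.MathematicalPhysics.QuantumFieldTheory.Balaban1983to89.Beta
open ExpKernelCalculus (MKer Decays BiLoc VertexFamily VertexFamily₂ comp)
open KernelWard (divV divW)
open AffineAveraging (box toSite)
open OneStepResolventKernel (Fib LocStencil)
open OneStepKernelFamily (colH vertexOfK)
open BalabanStepJetsSucc (mmRead wE wVH)
open SecondOrderResponse (vertexOfM dM K2OfK LocStencilFM)
open BalabanCompositeJets (LocStencil₂)
open BalabanStepW2 (M2Of wV4 wB2)
open StepJetData (wilsonA)
open WilsonBiStencil (wilsonW₂)
open Summit.QuantumFields.BalabanUV.Beta.TameKernelCalculus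
open Summit.QuantumFields.BalabanUV.Beta.ChartConjugation (conjV)
open Summit.QuantumFields.BalabanUV.Beta.ChartConjugationRelative (RelInv)
open Summit.QuantumFields.BalabanUV.Beta.BorderedHessian (diagK)
open Summit.QuantumFields.BalabanUV.Beta.AveragingWardRootedStencils (legInd)
open Summit.QuantumFields.BalabanUV.Beta.SpineRooted (e4OfKW e3OfK SpureRecOf SpureRecOf_zero_level SpureRecOf_succ locStencil_SpureRecOf T2RecOf
  T2RecOf_zero_level T2RecOf_succ WrecOf WrecOf_swap vertexFamily₂_WrecOf')
open Summit.QuantumFields.BalabanUV.Beta.WardLocusRecursive (SrecOf)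
open Summit.QuantumFields.BalabanUV.Beta.SecondOrderContactMmRead (mmRead_K2OfK_eq_e3OfK)
open Summit.QuantumFields.BalabanUV.Beta.KernelWardLevels (loc_diagK_smul_sum_legInd)
open Summit.QuantumFields.BalabanUV.Beta.WardLocusQuartic (tableLaw_e4OfKW_sector)
open Summit.QuantumFields.BalabanUV.Beta.WardLocusQuarticTable (sectorLaw_add sectorLaw_add'' tableLaw_e4OfKW_sector'')

namespace Summit.QuantumFields.BalabanUV.Beta.WardLocusQuarticTableSlot

section Slot

variable {d Lc : ℕ} [NeZero Lc]
variable {V H : Fin (d + 1) → (Fin (d + 1) → ℤ) → MKer (d + 1) (Fib d)} {G : ℕ → MKer (d + 1) (Fib d)}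
  {M : ℕ → Fin (d + 1) → (Fin (d + 1) → ℤ) → MKer (d + 1) (Fib d)}

/-! ## §1 Level `j+1`: the table laws of `T2RecOf … (j+1)` against `SpureRecOf … (j+1)`, both slots -/

/-- [folklore] **THE `hS₂` LAW OF THE NEXT LEVEL's FIELD TABLE `T2RecOf G (SpureRecOf V H G) M … (j+1)`, FIRST SLOT, SLOT-GENERIC.**  Letters of
the slots: (LV) `V` localised at every rate, (LH) `H` a vertex family at every rate, (DG) for `G`, (LM) for `M`, binder classes `hB`∕`hmix`; at level `j`:
spreads `𝕄`, `E` with `RelInv (G j) 𝕄 E`, an in-block root `r` and generator scale `ξ` with `[E, X y] = 0` for `X y = diagK (ξ • Σ_v legInd (toSite r) (Lc•y+v))`,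
the first-order law `hD` of `dM (G j) Lc (SpureRecOf … j) (M j)` against `𝕄`, the order-one consistency (c1) `hc1` at level `j`, the level-`j` KERNEL law `hWd`
of `WrecOf … j` with a localised residual `𝒩`, the lock `cH′·(cE₂·wV4 (j+1))·ξ = (cE·wE (j+1))·ξ`, and the BORDER letter `hBord` of the sector
`(cB·wB2 (j+1)) • vh₂S` against `(cVH·wVH (j+1)) • V` (remainder `RB`).  CONCLUSION: the `hS₂` law of `T2RecOf … (j+1)` against `SpureRecOf … (j+1)` with
remainder `−(cH′·(cE₂·wV4 (j+1))) • Σ_v mmRead Lc (G j ∘ 𝒩 (Lc•Y+v) κ′ u′ ∘ G j) + RB Y κ′ u′`. -/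
theorem tableLaw_T2RecOf_succ (hLc : 1 ≤ Lc) (hV : ∀ δ : ℝ, 0 ≤ δ → ∃ C : ℝ, LocStencil V C δ)
    (hH : ∀ δ : ℝ, 0 ≤ δ → ∃ C : ℝ, VertexFamily H Lc C δ) (hG : ∀ j : ℕ, ∃ δ C : ℝ, 0 < δ ∧ 0 ≤ C ∧ Decays (G j) C δ)
    (hM : ∀ j : ℕ, ∃ CM δ : ℝ, 0 < δ ∧ VertexFamily (M j) Lc CM δ) (cE cVH cΛ cE₂ cB : ℝ) (T : Fin 4 → Fin 4 → Fin 4 → Fin 4 → ℝ)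
    {vh₂S : Fin (d + 1) → (Fin (d + 1) → ℤ) → Fin (d + 1) → (Fin (d + 1) → ℤ) → MKer (d + 1) (Fib d)}
    (hB : ∃ C δ : ℝ, 0 < δ ∧ LocStencil₂ vh₂S C δ)
    {mixFF : Fin (d + 1) → (Fin (d + 1) → ℤ) → Fin (d + 1) → (Fin (d + 1) → ℤ) → MKer (d + 1) (Fib d)}
    (hmix : ∃ C δ : ℝ, 0 < δ ∧ LocStencilFM Lc mixFF C δ) (j : ℕ)
    {𝕄 E : MKer (d + 1) (Fib d)} (h𝕄 : Spr 𝕄) (hE : Spr E) (hR : RelInv (G j) 𝕄 E)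
    {r : Fin (d + 1) → ℕ} (hr : r ∈ box (d + 1) Lc) (ξ : ℝ)
    (hEX : ∀ y : Fin (d + 1) → ℤ, comp E (diagK (ξ • ∑ v ∈ box (d + 1) Lc, legInd (toSite r) ((Lc : ℤ) • y + toSite v))) =
      comp (diagK (ξ • ∑ v ∈ box (d + 1) Lc, legInd (toSite r) ((Lc : ℤ) • y + toSite v))) E)
    (hD : ∀ y : Fin (d + 1) → ℤ, divV (dM (G j) Lc (SpureRecOf d Lc V H G cE cVH cΛ j) (M j)) y =
      conjV 𝕄 (diagK (ξ • ∑ v ∈ box (d + 1) Lc, legInd (toSite r) ((Lc : ℤ) • y + toSite v))))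
    (hc1 : ∀ (κ : Fin (d + 1)) (u : Fin (d + 1) → ℤ),
      dM (G j) Lc (SpureRecOf d Lc V H G cE cVH cΛ j) (M j) κ u = vertexOfK (G j) Lc (SrecOf d Lc V H G cE cVH cΛ j) κ u)
    {𝒩 : (Fin (d + 1) → ℤ) → Fin (d + 1) → (Fin (d + 1) → ℤ) → MKer (d + 1) (Fib d)} (h𝒩 : ∀ y ν y', Loc (𝒩 y ν y'))
    (hWd : ∀ (y : Fin (d + 1) → ℤ) (ν : Fin (d + 1)) (y' : Fin (d + 1) → ℤ),
      divW (WrecOf d Lc G (SpureRecOf d Lc V H G cE cVH cΛ) M cE₂ cB T vh₂S mixFF j) y ν y' =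
        conjV (dM (G j) Lc (SpureRecOf d Lc V H G cE cVH cΛ j) (M j) ν y')
          (diagK (ξ • ∑ v ∈ box (d + 1) Lc, legInd (toSite r) ((Lc : ℤ) • y + toSite v))) + 𝒩 y ν y')
    {cH' : ℝ} (hlock : cH' * (cE₂ * wV4 d Lc (j + 1)) * ξ = (cE * wE d Lc (j + 1)) * ξ)
    {RB : (Fin (d + 1) → ℤ) → Fin (d + 1) → (Fin (d + 1) → ℤ) → MKer (d + 1) (Fib d)}
    (hBord : ∀ (Y : Fin (d + 1) → ℤ) (κ' : Fin (d + 1)) (u' : Fin (d + 1) → ℤ),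
      cH' • ∑ v ∈ box (d + 1) Lc, divV (fun κ u => (cB * wB2 d Lc (j + 1)) • vh₂S κ u κ' u') ((Lc : ℤ) • Y + toSite v) =
        comp ((cVH * wVH d Lc (j + 1)) • V κ' u') (diagK (ξ • ∑ v ∈ box (d + 1) Lc, legInd (toSite r) ((Lc : ℤ) • Y + toSite v)))
          - comp (diagK (ξ • ∑ v ∈ box (d + 1) Lc, legInd (toSite r) ((Lc : ℤ) • Y + toSite v))) ((cVH * wVH d Lc (j + 1)) • V κ' u')
          + RB Y κ' u')
    (Y : Fin (d + 1) → ℤ) (κ' : Fin (d + 1)) (u' : Fin (d + 1) → ℤ) :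
    cH' • ∑ v ∈ box (d + 1) Lc, divV (fun κ u =>
        T2RecOf d Lc G (SpureRecOf d Lc V H G cE cVH cΛ) M cE₂ cB T vh₂S mixFF (j + 1) κ u κ' u') ((Lc : ℤ) • Y + toSite v) =
      comp (SpureRecOf d Lc V H G cE cVH cΛ (j + 1) κ' u') (diagK (ξ • ∑ v ∈ box (d + 1) Lc, legInd (toSite r) ((Lc : ℤ) • Y + toSite v)))
        - comp (diagK (ξ • ∑ v ∈ box (d + 1) Lc, legInd (toSite r) ((Lc : ℤ) • Y + toSite v))) (SpureRecOf d Lc V H G cE cVH cΛ (j + 1) κ' u')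
        + (-(cH' * (cE₂ * wV4 d Lc (j + 1))) • ∑ v ∈ box (d + 1) Lc,
              mmRead Lc (comp (comp (G j) (𝒩 ((Lc : ℤ) • Y + toSite v) κ' u')) (G j))
            + RB Y κ' u') := by
  obtain ⟨δK, CK, hδK, hCK, hKd⟩ := hG j
  have hKs : Spr (G j) := ⟨CK, δK, hδK, hKd⟩
  obtain ⟨Cs, δs, hδs, hS⟩ := locStencil_SpureRecOf (d := d) hLc hV hH hG cE cVH cΛ j
  obtain ⟨CM, δM, hδM, hMl⟩ := hM j
  -- the first-order family is localised (common rate)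
  have hm : 0 < min δs (min δM δK) := lt_min hδs (lt_min hδM hδK)
  have hDl : ∀ μ y, Loc (dM (G j) Lc (SpureRecOf d Lc V H G cE cVH cΛ j) (M j) μ y) := fun μ y =>
    SecondOrderTransport.loc_dM hKd hCK (Cs := |Cs|) (fun κ u => biLoc_of_le (hS κ u) (min_le_left _ _))
      (fun ρ w => biLoc_of_le (hMl ρ w) ((min_le_right _ _).trans (min_le_left _ _))) hm ((min_le_right _ _).trans (min_le_right _ _)) μ y
  obtain ⟨Cw, δw, hδw, hW2⟩ := vertexFamily₂_WrecOf' cE₂ cB T vh₂S mixFF hLc hG (locStencil_SpureRecOf (d := d) hLc hV hH hG cE cVH cΛ) hM hB hmix j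
  have hWl : ∀ μ y ν y', Loc (WrecOf d Lc G (SpureRecOf d Lc V H G cE cVH cΛ) M cE₂ cB T vh₂S mixFF j μ y ν y') := fun μ y ν y' =>
    ⟨_, _, _, _, hδw, hW2 μ y ν y'⟩
  -- the `e4OfKW` sector (leaf-10's table law, the `mm`-read identified with the cubic sector of the next pure table through (c1))
  have hA : ∀ (Y : Fin (d + 1) → ℤ) (κ' : Fin (d + 1)) (u' : Fin (d + 1) → ℤ),
      cH' • ∑ v ∈ box (d + 1) Lc, divV (fun κ u => (cE₂ * wV4 d Lc (j + 1)) •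
          e4OfKW Lc (G j) (SpureRecOf d Lc V H G cE cVH cΛ j) (M j) (WrecOf d Lc G (SpureRecOf d Lc V H G cE cVH cΛ) M cE₂ cB T vh₂S mixFF j)
            κ u κ' u') ((Lc : ℤ) • Y + toSite v) =
        comp ((cE * wE d Lc (j + 1)) • e3OfK Lc (G j) (SrecOf d Lc V H G cE cVH cΛ j) κ' u')
            (diagK (ξ • ∑ v ∈ box (d + 1) Lc, legInd (toSite r) ((Lc : ℤ) • Y + toSite v)))
          - comp (diagK (ξ • ∑ v ∈ box (d + 1) Lc, legInd (toSite r) ((Lc : ℤ) • Y + toSite v)))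
            ((cE * wE d Lc (j + 1)) • e3OfK Lc (G j) (SrecOf d Lc V H G cE cVH cΛ j) κ' u')
          + -(cH' * (cE₂ * wV4 d Lc (j + 1))) • ∑ v ∈ box (d + 1) Lc,
              mmRead Lc (comp (comp (G j) (𝒩 ((Lc : ℤ) • Y + toSite v) κ' u')) (G j)) := by
    intro Y κ' u'
    rw [← mmRead_K2OfK_eq_e3OfK _ κ' u' (hc1 κ' u')]
    exact tableLaw_e4OfKW_sector hKs h𝕄 hE hR hDl hWl hr ξ (fun y => loc_diagK_smul_sum_legInd Lc (toSite r) _ y) hEX hD h𝒩 hWd hlock Lc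
      (toSite r) Y κ' u'
  have h := sectorLaw_add (N' := Lc) hA hBord Y κ' u'
  simpa only [T2RecOf_succ, SpureRecOf_succ] using h

/-- [folklore] **THE `hS₂''` LAW OF `T2RecOf … (j+1)`, SECOND SLOT, SLOT-GENERIC** — the same with the divergence in the second bond: the `e4OfKW` sector by
`tableLaw_e4OfKW_sector''` (swap symmetry `WrecOf_swap`), the border sector by its second-slot letter `hBord''` (remainder `RB''`). -/
theorem tableLaw_T2RecOf_succ'' (hLc : 1 ≤ Lc) (hV : ∀ δ : ℝ, 0 ≤ δ → ∃ C : ℝ, LocStencil V C δ)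
    (hH : ∀ δ : ℝ, 0 ≤ δ → ∃ C : ℝ, VertexFamily H Lc C δ) (hG : ∀ j : ℕ, ∃ δ C : ℝ, 0 < δ ∧ 0 ≤ C ∧ Decays (G j) C δ)
    (hM : ∀ j : ℕ, ∃ CM δ : ℝ, 0 < δ ∧ VertexFamily (M j) Lc CM δ) (cE cVH cΛ cE₂ cB : ℝ) (T : Fin 4 → Fin 4 → Fin 4 → Fin 4 → ℝ)
    {vh₂S : Fin (d + 1) → (Fin (d + 1) → ℤ) → Fin (d + 1) → (Fin (d + 1) → ℤ) → MKer (d + 1) (Fib d)}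
    (hB : ∃ C δ : ℝ, 0 < δ ∧ LocStencil₂ vh₂S C δ)
    {mixFF : Fin (d + 1) → (Fin (d + 1) → ℤ) → Fin (d + 1) → (Fin (d + 1) → ℤ) → MKer (d + 1) (Fib d)}
    (hmix : ∃ C δ : ℝ, 0 < δ ∧ LocStencilFM Lc mixFF C δ) (j : ℕ)
    {𝕄 E : MKer (d + 1) (Fib d)} (h𝕄 : Spr 𝕄) (hE : Spr E) (hR : RelInv (G j) 𝕄 E)
    {r : Fin (d + 1) → ℕ} (hr : r ∈ box (d + 1) Lc) (ξ : ℝ)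
    (hEX : ∀ y : Fin (d + 1) → ℤ, comp E (diagK (ξ • ∑ v ∈ box (d + 1) Lc, legInd (toSite r) ((Lc : ℤ) • y + toSite v))) =
      comp (diagK (ξ • ∑ v ∈ box (d + 1) Lc, legInd (toSite r) ((Lc : ℤ) • y + toSite v))) E)
    (hD : ∀ y : Fin (d + 1) → ℤ, divV (dM (G j) Lc (SpureRecOf d Lc V H G cE cVH cΛ j) (M j)) y =
      conjV 𝕄 (diagK (ξ • ∑ v ∈ box (d + 1) Lc, legInd (toSite r) ((Lc : ℤ) • y + toSite v))))
    (hc1 : ∀ (κ : Fin (d + 1)) (u : Fin (d + 1) → ℤ),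
      dM (G j) Lc (SpureRecOf d Lc V H G cE cVH cΛ j) (M j) κ u = vertexOfK (G j) Lc (SrecOf d Lc V H G cE cVH cΛ j) κ u)
    {𝒩 : (Fin (d + 1) → ℤ) → Fin (d + 1) → (Fin (d + 1) → ℤ) → MKer (d + 1) (Fib d)} (h𝒩 : ∀ y ν y', Loc (𝒩 y ν y'))
    (hWd : ∀ (y : Fin (d + 1) → ℤ) (ν : Fin (d + 1)) (y' : Fin (d + 1) → ℤ),
      divW (WrecOf d Lc G (SpureRecOf d Lc V H G cE cVH cΛ) M cE₂ cB T vh₂S mixFF j) y ν y' =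
        conjV (dM (G j) Lc (SpureRecOf d Lc V H G cE cVH cΛ j) (M j) ν y')
          (diagK (ξ • ∑ v ∈ box (d + 1) Lc, legInd (toSite r) ((Lc : ℤ) • y + toSite v))) + 𝒩 y ν y')
    {cH' : ℝ} (hlock : cH' * (cE₂ * wV4 d Lc (j + 1)) * ξ = (cE * wE d Lc (j + 1)) * ξ)
    {RB'' : (Fin (d + 1) → ℤ) → Fin (d + 1) → (Fin (d + 1) → ℤ) → MKer (d + 1) (Fib d)}
    (hBord'' : ∀ (Y : Fin (d + 1) → ℤ) (κ : Fin (d + 1)) (u : Fin (d + 1) → ℤ),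
      cH' • ∑ v ∈ box (d + 1) Lc, divV (fun κ' u' => (cB * wB2 d Lc (j + 1)) • vh₂S κ u κ' u') ((Lc : ℤ) • Y + toSite v) =
        comp ((cVH * wVH d Lc (j + 1)) • V κ u) (diagK (ξ • ∑ v ∈ box (d + 1) Lc, legInd (toSite r) ((Lc : ℤ) • Y + toSite v)))
          - comp (diagK (ξ • ∑ v ∈ box (d + 1) Lc, legInd (toSite r) ((Lc : ℤ) • Y + toSite v))) ((cVH * wVH d Lc (j + 1)) • V κ u)
          + RB'' Y κ u)
    (Y : Fin (d + 1) → ℤ) (κ : Fin (d + 1)) (u : Fin (d + 1) → ℤ) :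
    cH' • ∑ v ∈ box (d + 1) Lc, divV
        (T2RecOf d Lc G (SpureRecOf d Lc V H G cE cVH cΛ) M cE₂ cB T vh₂S mixFF (j + 1) κ u) ((Lc : ℤ) • Y + toSite v) =
      comp (SpureRecOf d Lc V H G cE cVH cΛ (j + 1) κ u) (diagK (ξ • ∑ v ∈ box (d + 1) Lc, legInd (toSite r) ((Lc : ℤ) • Y + toSite v)))
        - comp (diagK (ξ • ∑ v ∈ box (d + 1) Lc, legInd (toSite r) ((Lc : ℤ) • Y + toSite v))) (SpureRecOf d Lc V H G cE cVH cΛ (j + 1) κ u)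
        + (-(cH' * (cE₂ * wV4 d Lc (j + 1))) • ∑ v ∈ box (d + 1) Lc,
              mmRead Lc (comp (comp (G j) (𝒩 ((Lc : ℤ) • Y + toSite v) κ u)) (G j))
            + RB'' Y κ u) := by
  obtain ⟨δK, CK, hδK, hCK, hKd⟩ := hG j
  have hKs : Spr (G j) := ⟨CK, δK, hδK, hKd⟩
  obtain ⟨Cs, δs, hδs, hS⟩ := locStencil_SpureRecOf (d := d) hLc hV hH hG cE cVH cΛ j
  obtain ⟨CM, δM, hδM, hMl⟩ := hM j
  have hm : 0 < min δs (min δM δK) := lt_min hδs (lt_min hδM hδK)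
  have hDl : ∀ μ y, Loc (dM (G j) Lc (SpureRecOf d Lc V H G cE cVH cΛ j) (M j) μ y) := fun μ y =>
    SecondOrderTransport.loc_dM hKd hCK (Cs := |Cs|) (fun κ u => biLoc_of_le (hS κ u) (min_le_left _ _))
      (fun ρ w => biLoc_of_le (hMl ρ w) ((min_le_right _ _).trans (min_le_left _ _))) hm ((min_le_right _ _).trans (min_le_right _ _)) μ y
  obtain ⟨Cw, δw, hδw, hW2⟩ := vertexFamily₂_WrecOf' cE₂ cB T vh₂S mixFF hLc hG (locStencil_SpureRecOf (d := d) hLc hV hH hG cE cVH cΛ) hM hB hmix j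
  have hWl : ∀ μ y ν y', Loc (WrecOf d Lc G (SpureRecOf d Lc V H G cE cVH cΛ) M cE₂ cB T vh₂S mixFF j μ y ν y') := fun μ y ν y' =>
    ⟨_, _, _, _, hδw, hW2 μ y ν y'⟩
  have hA : ∀ (Y : Fin (d + 1) → ℤ) (κ : Fin (d + 1)) (u : Fin (d + 1) → ℤ),
      cH' • ∑ v ∈ box (d + 1) Lc, divV (fun κ' u' => (cE₂ * wV4 d Lc (j + 1)) •
          e4OfKW Lc (G j) (SpureRecOf d Lc V H G cE cVH cΛ j) (M j) (WrecOf d Lc G (SpureRecOf d Lc V H G cE cVH cΛ) M cE₂ cB T vh₂S mixFF j)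
            κ u κ' u') ((Lc : ℤ) • Y + toSite v) =
        comp ((cE * wE d Lc (j + 1)) • e3OfK Lc (G j) (SrecOf d Lc V H G cE cVH cΛ j) κ u)
            (diagK (ξ • ∑ v ∈ box (d + 1) Lc, legInd (toSite r) ((Lc : ℤ) • Y + toSite v)))
          - comp (diagK (ξ • ∑ v ∈ box (d + 1) Lc, legInd (toSite r) ((Lc : ℤ) • Y + toSite v)))
            ((cE * wE d Lc (j + 1)) • e3OfK Lc (G j) (SrecOf d Lc V H G cE cVH cΛ j) κ u)
          + -(cH' * (cE₂ * wV4 d Lc (j + 1))) • ∑ v ∈ box (d + 1) Lc,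
              mmRead Lc (comp (comp (G j) (𝒩 ((Lc : ℤ) • Y + toSite v) κ u)) (G j)) := by
    intro Y κ u
    rw [← mmRead_K2OfK_eq_e3OfK _ κ u (hc1 κ u)]
    exact tableLaw_e4OfKW_sector'' hKs h𝕄 hE hR hDl hWl
      (WrecOf_swap G (SpureRecOf d Lc V H G cE cVH cΛ) M cE₂ cB T vh₂S mixFF j) hr ξ
      (fun y => loc_diagK_smul_sum_legInd Lc (toSite r) _ y) hEX hD h𝒩 hWd hlock Lc (toSite r) Y κ u
  have h := sectorLaw_add'' (N' := Lc) (S₂A := fun κ u κ' u' => (cE₂ * wV4 d Lc (j + 1)) •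
      e4OfKW Lc (G j) (SpureRecOf d Lc V H G cE cVH cΛ j) (M j) (WrecOf d Lc G (SpureRecOf d Lc V H G cE cVH cΛ) M cE₂ cB T vh₂S mixFF j)
        κ u κ' u')
    (S₂B := fun κ u κ' u' => (cB * wB2 d Lc (j + 1)) • vh₂S κ u κ' u') hA hBord'' Y κ u
  simpa only [T2RecOf_succ, SpureRecOf_succ] using h

/-! ## §2 Level `0`: the Wilson letter + the border letter ⇒ the table laws of `T2RecOf … 0` against `SpureRecOf … 0` -/

/-- [folklore] **THE `hS₂` LAW OF THE LEVEL-0 FIELD TABLE `T2RecOf … 0 = cE₂ • wilsonW₂ d T + cB • vh₂S`, FIRST SLOT, SLOT-GENERIC**, against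
`SpureRecOf … 0 = cE • wilsonA d + cVH • V`: from the WILSON letter `hWil` of the sector `cE₂ • wilsonW₂ d T` against `cE • wilsonA d` (remainder `RW`) and the
BORDER letter `hBord` of `cB • vh₂S` against `cVH • V` (remainder `RB`), same constant, same diagonal generator `diagK (g Y)`.  Pure `sectorLaw_add` bookkeeping. -/
theorem tableLaw_T2RecOf_zero (cE cVH cΛ cE₂ cB : ℝ) (T : Fin 4 → Fin 4 → Fin 4 → Fin 4 → ℝ)
    (vh₂S mixFF : Fin (d + 1) → (Fin (d + 1) → ℤ) → Fin (d + 1) → (Fin (d + 1) → ℤ) → MKer (d + 1) (Fib d)) {cH' : ℝ}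
    {g : (Fin (d + 1) → ℤ) → (Fin (d + 1) → ℤ) → Fib d → ℝ}
    {RW RB : (Fin (d + 1) → ℤ) → Fin (d + 1) → (Fin (d + 1) → ℤ) → MKer (d + 1) (Fib d)}
    (hWil : ∀ (Y : Fin (d + 1) → ℤ) (κ' : Fin (d + 1)) (u' : Fin (d + 1) → ℤ),
      cH' • ∑ v ∈ box (d + 1) Lc, divV (fun κ u => cE₂ • wilsonW₂ d T κ u κ' u') ((Lc : ℤ) • Y + toSite v) =
        comp (cE • wilsonA d κ' u') (diagK (g Y)) - comp (diagK (g Y)) (cE • wilsonA d κ' u') + RW Y κ' u')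
    (hBord : ∀ (Y : Fin (d + 1) → ℤ) (κ' : Fin (d + 1)) (u' : Fin (d + 1) → ℤ),
      cH' • ∑ v ∈ box (d + 1) Lc, divV (fun κ u => cB • vh₂S κ u κ' u') ((Lc : ℤ) • Y + toSite v) =
        comp (cVH • V κ' u') (diagK (g Y)) - comp (diagK (g Y)) (cVH • V κ' u') + RB Y κ' u')
    (Y : Fin (d + 1) → ℤ) (κ' : Fin (d + 1)) (u' : Fin (d + 1) → ℤ) :
    cH' • ∑ v ∈ box (d + 1) Lc, divV (fun κ u => T2RecOf d Lc G (SpureRecOf d Lc V H G cE cVH cΛ) M cE₂ cB T vh₂S mixFF 0 κ u κ' u')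
        ((Lc : ℤ) • Y + toSite v) =
      comp (SpureRecOf d Lc V H G cE cVH cΛ 0 κ' u') (diagK (g Y)) - comp (diagK (g Y)) (SpureRecOf d Lc V H G cE cVH cΛ 0 κ' u')
        + (RW Y κ' u' + RB Y κ' u') := by
  have h := sectorLaw_add (N' := Lc) hWil hBord Y κ' u'
  simpa only [T2RecOf_zero_level, SpureRecOf_zero_level] using h

/-- [folklore] **THE `hS₂''` LAW OF THE LEVEL-0 FIELD TABLE, SECOND SLOT, SLOT-GENERIC**, from the second-slot Wilson letter `hWil''` and border letter
`hBord''`. -/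
theorem tableLaw_T2RecOf_zero'' (cE cVH cΛ cE₂ cB : ℝ) (T : Fin 4 → Fin 4 → Fin 4 → Fin 4 → ℝ)
    (vh₂S mixFF : Fin (d + 1) → (Fin (d + 1) → ℤ) → Fin (d + 1) → (Fin (d + 1) → ℤ) → MKer (d + 1) (Fib d)) {cH' : ℝ}
    {g : (Fin (d + 1) → ℤ) → (Fin (d + 1) → ℤ) → Fib d → ℝ}
    {RW'' RB'' : (Fin (d + 1) → ℤ) → Fin (d + 1) → (Fin (d + 1) → ℤ) → MKer (d + 1) (Fib d)}
    (hWil'' : ∀ (Y : Fin (d + 1) → ℤ) (κ : Fin (d + 1)) (u : Fin (d + 1) → ℤ),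
      cH' • ∑ v ∈ box (d + 1) Lc, divV (fun κ' u' => cE₂ • wilsonW₂ d T κ u κ' u') ((Lc : ℤ) • Y + toSite v) =
        comp (cE • wilsonA d κ u) (diagK (g Y)) - comp (diagK (g Y)) (cE • wilsonA d κ u) + RW'' Y κ u)
    (hBord'' : ∀ (Y : Fin (d + 1) → ℤ) (κ : Fin (d + 1)) (u : Fin (d + 1) → ℤ),
      cH' • ∑ v ∈ box (d + 1) Lc, divV (fun κ' u' => cB • vh₂S κ u κ' u') ((Lc : ℤ) • Y + toSite v) =
        comp (cVH • V κ u) (diagK (g Y)) - comp (diagK (g Y)) (cVH • V κ u) + RB'' Y κ u)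
    (Y : Fin (d + 1) → ℤ) (κ : Fin (d + 1)) (u : Fin (d + 1) → ℤ) :
    cH' • ∑ v ∈ box (d + 1) Lc, divV (T2RecOf d Lc G (SpureRecOf d Lc V H G cE cVH cΛ) M cE₂ cB T vh₂S mixFF 0 κ u)
        ((Lc : ℤ) • Y + toSite v) =
      comp (SpureRecOf d Lc V H G cE cVH cΛ 0 κ u) (diagK (g Y)) - comp (diagK (g Y)) (SpureRecOf d Lc V H G cE cVH cΛ 0 κ u)
        + (RW'' Y κ u + RB'' Y κ u) := by
  have h := sectorLaw_add'' (N' := Lc) (S₂A := fun κ u κ' u' => cE₂ • wilsonW₂ d T κ u κ' u')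
    (S₂B := fun κ u κ' u' => cB • vh₂S κ u κ' u') hWil'' hBord'' Y κ u
  simpa only [T2RecOf_zero_level, SpureRecOf_zero_level] using h

end Slot

end Summit.QuantumFields.BalabanUV.Beta.WardLocusQuarticTableSlot

end
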